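import Mathlib
import Summits.NavierStokesRegularity.NavierStokesRegularity.Theorems.EulerZoomLiouvillePowerGaugeEulerLiouvillePressureFloorShellMean
import Summits.NavierStokesRegularity.NavierStokesRegularity.Theorems.EulerZoomLiouvillePowerGaugeEulerLiouvillePressureFloorShellTransform
import HarnessLib

/-!
# Crux `EulerZoomLiouville.PowerGaugeEulerLiouville` (stmt-NavierStokesRegularity-19832), line `pressure-floor`, stub A2 — brick 3:
# THE RADIAL PROFILE: ENCLOSED MASS, THE EXTERIOR TAIL `h = Q₀ σ^{-3/2}`, AND THE NORMALISED PRIMITIVE `g`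

Route №10 `EulerZoomLiouville` (NavierStokesRegularity), crux E.  Line `pressure-floor` (ideator ns-idea-11), registered stub
`stub_newtonianBumps` (A2).  Seat ns-ezl-w3 (W-PF1/A2).  Continues brick 2 (`…PressureFloorShellTransform`): for a smooth density
`ρ ≥ 0` vanishing on `[a, ∞)` (`a > 0`; in the application `a = 2R²`) and its shell transform `h` (`4σ h' + 6h = ρ`), the
ENCLOSED-MASS quantity `Q(σ) = σ^{3/2} h(σ)` (`= F(r)/2`, `F(r) = ∫₀ʳ s² ρ(s²) ds`, `r = √σ`) has `Q' = σ^{1/2} ρ / 4 ≥ 0`, so it is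
non-decreasing on `[0, ∞)` and CONSTANT `= Q₀ := Q(a)` on `[a, ∞)` (no mass outside the support).  Consequences (theorems only, no
definitions — `ρ`, `h`, `g` enter through hypotheses):

* `hasDerivAt_enclosedMass` — `Q'(σ) = σ^{1/2} ρ(σ)/4` for `σ > 0`;
* `enclosedMass_le`, `enclosedMass_eq` — `Q(σ) ≤ Q₀` for `σ ≥ 0`, `Q(σ) = Q₀` for `σ ≥ a`;
* `shellTransform_le_tail`, `shellTransform_eq_tail` — `h(σ) ≤ Q₀ σ^{−3/2}` for `σ > 0`, with equality for `σ ≥ a` (Newton's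
  theorem: outside the support the field is that of a point mass);
* `enclosedMass_le_of_profile` — for the cut density of brick 2 (`ρ ≤ (1+σ)^{−β/2}` on `[0,∞)`, `a = 2R²`):
  `Q₀ ≤ ½ (2R²)^{(3−β)/2}/(3−β)` (brick 1 `shellMean_upper` and `(1+a)^{−β/2} ≤ a^{−β/2}`);
* `exists_primitive` — a smooth primitive `g` of `h` with a prescribed value at one point;
* `primitive_eq_tail` — if `g' = h`, `h = Q₀ σ^{−3/2}` on `[a, ∞)` and `g(a) = −2Q₀ a^{−1/2}`, then `g(σ) = −2 Q₀ σ^{−1/2}` for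
  `σ ≥ a` (the Newtonian potential `−M/r` outside the support);
* `exists_bound_primitive` — `|g| ≤ B` on `[0, a]`.

WHAT THIS IS NOT: not NS, not the crux — a helper `--supports` stmt-19832 on the line `pressure-floor` (pure real analysis;
19832 is a crux CLASS of Euler/NS strata and stays OPEN; nothing here bears on NS regularity). [folklore]
-/

noncomputable section

-- flat `Theorems/<Route><Decl>…` files of one crux share the namespace of the crux (tree convention)
set_option linter.dupNamespace false

open MeasureTheory Set Filter Topology intervalIntegral
open scoped ContDiff Topology

namespace Summit.NavierStokesRegularity.NavierStokesRegularity.Theorems.PowerGaugeEulerLiouville.PressureFloor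

section EnclosedMass

variable {ρ h : ℝ → ℝ} {a : ℝ}

/-- **Derivative of the enclosed mass** `Q(σ) = σ^{3/2} h(σ)`: for `σ > 0`, `Q'(σ) = σ^{1/2} ρ(σ) / 4` (product rule and the radial
Poisson equation `4σh' + 6h = ρ` of brick 2). [folklore] -/
theorem hasDerivAt_enclosedMass (hρ : ContDiff ℝ ∞ ρ)
    (hh : h = fun σ => 2⁻¹ * ∫ t in (0 : ℝ)..1, t ^ 2 * ρ (σ * t ^ 2)) {σ : ℝ} (hσ : 0 < σ) :
    HasDerivAt (fun σ : ℝ => σ ^ ((3 : ℝ) / 2) * h σ) (σ ^ ((1 : ℝ) / 2) * ρ σ / 4) σ := by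
  have hhd : Differentiable ℝ h := (contDiff_shellTransform hρ hh).differentiable (by simp)
  have hode := shellTransform_ode hρ hh σ
  have h1 : HasDerivAt (fun x : ℝ => x ^ ((3 : ℝ) / 2)) ((3 : ℝ) / 2 * σ ^ ((3 : ℝ) / 2 - 1)) σ :=
    Real.hasDerivAt_rpow_const (Or.inl hσ.ne')
  have h2 : HasDerivAt h (deriv h σ) σ := (hhd σ).hasDerivAt
  refine (h1.mul h2).congr_deriv ?_
  have e1 : σ ^ ((3 : ℝ) / 2 - 1) = σ ^ ((1 : ℝ) / 2) := by norm_num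
  have e2 : σ ^ ((3 : ℝ) / 2) = σ ^ ((1 : ℝ) / 2) * σ := by
    rw [← Real.rpow_add_one hσ.ne']; norm_num
  rw [e1, e2]
  linear_combination (σ ^ ((1 : ℝ) / 2) / 4) * hode

/-- The enclosed mass is continuous on `[0, ∞)` (indeed everywhere: `σ^{3/2}` and `h` are continuous). [folklore] -/
theorem continuous_enclosedMass (hρ : ContDiff ℝ ∞ ρ)
    (hh : h = fun σ => 2⁻¹ * ∫ t in (0 : ℝ)..1, t ^ 2 * ρ (σ * t ^ 2)) :
    Continuous fun σ : ℝ => σ ^ ((3 : ℝ) / 2) * h σ :=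
  (Real.continuous_rpow_const (by norm_num)).mul (contDiff_shellTransform hρ hh).continuous

/-- **The enclosed mass is non-decreasing on `[0, ∞)`** (`Q' = σ^{1/2}ρ/4 ≥ 0`). [folklore] -/
theorem monotoneOn_enclosedMass (hρ : ContDiff ℝ ∞ ρ) (hρ0 : ∀ s, 0 ≤ ρ s)
    (hh : h = fun σ => 2⁻¹ * ∫ t in (0 : ℝ)..1, t ^ 2 * ρ (σ * t ^ 2)) :
    MonotoneOn (fun σ : ℝ => σ ^ ((3 : ℝ) / 2) * h σ) (Ici 0) := by
  refine monotoneOn_of_deriv_nonneg (convex_Ici 0) (continuous_enclosedMass hρ hh).continuousOn ?_ ?_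
  · rw [interior_Ici]
    exact fun σ hσ => (hasDerivAt_enclosedMass hρ hh hσ).differentiableAt.differentiableWithinAt
  · rw [interior_Ici]
    intro σ hσ
    rw [(hasDerivAt_enclosedMass hρ hh hσ).deriv]
    exact div_nonneg (mul_nonneg (Real.rpow_nonneg (le_of_lt hσ) _) (hρ0 σ)) (by norm_num)

/-- **The enclosed mass is constant beyond the support**: on `[a, ∞)` (`a > 0`, `ρ = 0` there) `Q` is also non-increasing. [folklore] -/
theorem antitoneOn_enclosedMass (hρ : ContDiff ℝ ∞ ρ) (ha : 0 < a) (hρa : ∀ s, a ≤ s → ρ s = 0)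
    (hh : h = fun σ => 2⁻¹ * ∫ t in (0 : ℝ)..1, t ^ 2 * ρ (σ * t ^ 2)) :
    AntitoneOn (fun σ : ℝ => σ ^ ((3 : ℝ) / 2) * h σ) (Ici a) := by
  refine antitoneOn_of_deriv_nonpos (convex_Ici a) (continuous_enclosedMass hρ hh).continuousOn ?_ ?_
  · rw [interior_Ici]
    exact fun σ hσ => (hasDerivAt_enclosedMass hρ hh (ha.trans hσ)).differentiableAt.differentiableWithinAt
  · rw [interior_Ici]
    intro σ hσ
    rw [(hasDerivAt_enclosedMass hρ hh (ha.trans hσ)).deriv, hρa σ (le_of_lt hσ), mul_zero, zero_div]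

/-- `Q(σ) ≤ Q₀ = Q(a)` for every `σ ≥ 0`. [folklore] -/
theorem enclosedMass_le (hρ : ContDiff ℝ ∞ ρ) (hρ0 : ∀ s, 0 ≤ ρ s) (ha : 0 < a) (hρa : ∀ s, a ≤ s → ρ s = 0)
    (hh : h = fun σ => 2⁻¹ * ∫ t in (0 : ℝ)..1, t ^ 2 * ρ (σ * t ^ 2)) {σ : ℝ} (hσ : 0 ≤ σ) :
    σ ^ ((3 : ℝ) / 2) * h σ ≤ a ^ ((3 : ℝ) / 2) * h a := by
  rcases le_total σ a with hσa | hσa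
  · exact monotoneOn_enclosedMass hρ hρ0 hh (mem_Ici.2 hσ) (mem_Ici.2 ha.le) hσa
  · exact antitoneOn_enclosedMass hρ ha hρa hh (mem_Ici.2 le_rfl) (mem_Ici.2 hσa) hσa

/-- `Q(σ) = Q₀` for every `σ ≥ a`. [folklore] -/
theorem enclosedMass_eq (hρ : ContDiff ℝ ∞ ρ) (hρ0 : ∀ s, 0 ≤ ρ s) (ha : 0 < a) (hρa : ∀ s, a ≤ s → ρ s = 0)
    (hh : h = fun σ => 2⁻¹ * ∫ t in (0 : ℝ)..1, t ^ 2 * ρ (σ * t ^ 2)) {σ : ℝ} (hσ : a ≤ σ) :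
    σ ^ ((3 : ℝ) / 2) * h σ = a ^ ((3 : ℝ) / 2) * h a :=
  le_antisymm (enclosedMass_le hρ hρ0 ha hρa hh (ha.le.trans hσ))
    (monotoneOn_enclosedMass hρ hρ0 hh (mem_Ici.2 ha.le) (mem_Ici.2 (ha.le.trans hσ)) hσ)

/-- **The exterior tail bound**: `h(σ) ≤ Q₀ σ^{−3/2}` for every `σ > 0`. [folklore] -/
theorem shellTransform_le_tail (hρ : ContDiff ℝ ∞ ρ) (hρ0 : ∀ s, 0 ≤ ρ s) (ha : 0 < a) (hρa : ∀ s, a ≤ s → ρ s = 0)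
    (hh : h = fun σ => 2⁻¹ * ∫ t in (0 : ℝ)..1, t ^ 2 * ρ (σ * t ^ 2)) {σ : ℝ} (hσ : 0 < σ) :
    h σ ≤ a ^ ((3 : ℝ) / 2) * h a * σ ^ (-((3 : ℝ) / 2)) := by
  have hQ := enclosedMass_le hρ hρ0 ha hρa hh hσ.le
  have hpos : 0 < σ ^ (-((3 : ℝ) / 2)) := Real.rpow_pos_of_pos hσ _
  have hinv : σ ^ ((3 : ℝ) / 2) * σ ^ (-((3 : ℝ) / 2)) = 1 := by
    rw [← Real.rpow_add hσ]; norm_num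
  calc h σ = σ ^ ((3 : ℝ) / 2) * h σ * σ ^ (-((3 : ℝ) / 2)) := by
        rw [mul_comm (σ ^ ((3 : ℝ) / 2)) (h σ), mul_assoc, hinv, mul_one]
    _ ≤ a ^ ((3 : ℝ) / 2) * h a * σ ^ (-((3 : ℝ) / 2)) := mul_le_mul_of_nonneg_right hQ hpos.le

/-- **The exterior tail**: `h(σ) = Q₀ σ^{−3/2}` for every `σ ≥ a` (Newton: outside the support of the density the shell
transform is that of a point mass). [folklore] -/
theorem shellTransform_eq_tail (hρ : ContDiff ℝ ∞ ρ) (hρ0 : ∀ s, 0 ≤ ρ s) (ha : 0 < a) (hρa : ∀ s, a ≤ s → ρ s = 0)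
    (hh : h = fun σ => 2⁻¹ * ∫ t in (0 : ℝ)..1, t ^ 2 * ρ (σ * t ^ 2)) {σ : ℝ} (hσ : a ≤ σ) :
    h σ = a ^ ((3 : ℝ) / 2) * h a * σ ^ (-((3 : ℝ) / 2)) := by
  have hσ0 : 0 < σ := ha.trans_le hσ
  have hQ := enclosedMass_eq hρ hρ0 ha hρa hh hσ
  have hinv : σ ^ ((3 : ℝ) / 2) * σ ^ (-((3 : ℝ) / 2)) = 1 := by
    rw [← Real.rpow_add hσ0]; norm_num
  calc h σ = σ ^ ((3 : ℝ) / 2) * h σ * σ ^ (-((3 : ℝ) / 2)) := by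
        rw [mul_comm (σ ^ ((3 : ℝ) / 2)) (h σ), mul_assoc, hinv, mul_one]
    _ = a ^ ((3 : ℝ) / 2) * h a * σ ^ (-((3 : ℝ) / 2)) := by rw [hQ]

/-- **Size of the total mass for the cut-off profile**: if moreover `ρ ≤ (1+·)^{−β/2}` on `[0, ∞)` (`0 ≤ β < 1`) and `a = 2R²`,
then `Q₀ = (2R²)^{3/2} h(2R²) ≤ ½ (2R²)^{(3−β)/2} / (3 − β)` (brick 1 `shellMean_upper` at `σ = 2R²`, and `(1+2R²)^{−β/2} ≤ (2R²)^{−β/2}`).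
[folklore] -/
theorem enclosedMass_le_of_profile {β R : ℝ} (hβ : 0 ≤ β) (hβ1 : β < 1) (hR : 1 ≤ R) (hρc : Continuous ρ)
    (hρW : ∀ s, 0 ≤ s → ρ s ≤ (1 + s) ^ (-(β / 2)))
    (hh : h = fun σ => 2⁻¹ * ∫ t in (0 : ℝ)..1, t ^ 2 * ρ (σ * t ^ 2)) :
    (2 * R ^ 2) ^ ((3 : ℝ) / 2) * h (2 * R ^ 2) ≤ 2⁻¹ * (2 * R ^ 2) ^ ((3 - β) / 2) / (3 - β) := by
  have h3β : 0 < 3 - β := by linarith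
  have ha : 0 < 2 * R ^ 2 := by positivity
  have h1 := two_mul_shellTransform_le_shellMean (β := β) hρc hρW hh ha.le
  have h2 := shellMean_upper hβ (by linarith) ha.le
  have h3 : (1 + 2 * R ^ 2) ^ (-(β / 2)) ≤ (2 * R ^ 2) ^ (-(β / 2)) :=
    Real.rpow_le_rpow_of_nonpos ha (by linarith) (by linarith)
  have h4 : h (2 * R ^ 2) ≤ 2⁻¹ * ((2 * R ^ 2) ^ (-(β / 2)) / (3 - β)) := by
    have := (h1.trans h2).trans (div_le_div_of_nonneg_right h3 h3β.le)
    linarith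
  have h5 : 0 ≤ (2 * R ^ 2) ^ ((3 : ℝ) / 2) := Real.rpow_nonneg ha.le _
  calc (2 * R ^ 2) ^ ((3 : ℝ) / 2) * h (2 * R ^ 2)
      ≤ (2 * R ^ 2) ^ ((3 : ℝ) / 2) * (2⁻¹ * ((2 * R ^ 2) ^ (-(β / 2)) / (3 - β))) :=
        mul_le_mul_of_nonneg_left h4 h5
    _ = 2⁻¹ * ((2 * R ^ 2) ^ ((3 : ℝ) / 2) * (2 * R ^ 2) ^ (-(β / 2))) / (3 - β) := by ring
    _ = 2⁻¹ * (2 * R ^ 2) ^ ((3 - β) / 2) / (3 - β) := by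
        rw [← Real.rpow_add ha]
        congr 2
        ring

end EnclosedMass

/-! ### The normalised primitive `g` (`g' = h`) -/

section Primitive

variable {h g : ℝ → ℝ} {a Q₀ : ℝ}

/-- **A smooth primitive with a prescribed value**: for smooth `h` and any `σ₀, v₀` there is a smooth `g` with `g' = h`
everywhere and `g(σ₀) = v₀` (`g(σ) = v₀ + ∫_{σ₀}^σ h`). [folklore] -/
theorem exists_primitive (hh : ContDiff ℝ ∞ h) (σ₀ v₀ : ℝ) :
    ∃ g : ℝ → ℝ, ContDiff ℝ ∞ g ∧ (∀ σ, HasDerivAt g (h σ) σ) ∧ g σ₀ = v₀ := by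
  have hc : Continuous h := hh.continuous
  refine ⟨fun σ => v₀ + ∫ s in σ₀..σ, h s, ?_, ?_, by simp⟩
  · have hD : ∀ σ, HasDerivAt (fun σ => v₀ + ∫ s in σ₀..σ, h s) (h σ) σ := fun σ =>
      (intervalIntegral.integral_hasDerivAt_right (hc.intervalIntegrable _ _)
        (hc.stronglyMeasurableAtFilter _ _) hc.continuousAt).const_add v₀
    refine contDiff_infty_iff_deriv.2 ⟨fun σ => (hD σ).differentiableAt, ?_⟩
    have : deriv (fun σ => v₀ + ∫ s in σ₀..σ, h s) = h := funext fun σ => (hD σ).deriv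
    rw [this]
    exact hh
  · exact fun σ => (intervalIntegral.integral_hasDerivAt_right (hc.intervalIntegrable _ _)
      (hc.stronglyMeasurableAtFilter _ _) hc.continuousAt).const_add v₀

/-- **The potential outside the support**: if `g' = h` with `h(σ) = Q₀ σ^{−3/2}` on `[a, ∞)` (`a > 0`) and the normalisation
`g(a) = −2 Q₀ a^{−1/2}`, then `g(σ) = −2 Q₀ σ^{−1/2}` for all `σ ≥ a` (both sides have the same derivative on `[a, ∞)` and agree
at `a`; Mathlib's `constant_of_has_deriv_right_zero`). [folklore] -/
theorem primitive_eq_tail (ha : 0 < a) (hg : ∀ σ, HasDerivAt g (h σ) σ)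
    (htail : ∀ σ, a ≤ σ → h σ = Q₀ * σ ^ (-((3 : ℝ) / 2)))
    (hga : g a = -2 * Q₀ * a ^ (-((1 : ℝ) / 2))) {σ : ℝ} (hσ : a ≤ σ) :
    g σ = -2 * Q₀ * σ ^ (-((1 : ℝ) / 2)) := by
  -- `G(s) = g(s) + 2 Q₀ s^{-1/2}` has zero derivative on `[a, σ]`
  set G : ℝ → ℝ := fun s => g s + 2 * Q₀ * s ^ (-((1 : ℝ) / 2)) with hG
  have hGd : ∀ s, a ≤ s → HasDerivAt G 0 s := by
    intro s hs
    have hs0 : s ≠ 0 := (ha.trans_le hs).ne'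
    have h1 : HasDerivAt (fun x : ℝ => x ^ (-((1 : ℝ) / 2))) (-((1 : ℝ) / 2) * s ^ (-((1 : ℝ) / 2) - 1)) s :=
      Real.hasDerivAt_rpow_const (Or.inl hs0)
    have h2 := (hg s).add (h1.const_mul (2 * Q₀))
    refine h2.congr_deriv ?_
    rw [htail s hs]
    have e : s ^ (-((1 : ℝ) / 2) - 1) = s ^ (-((3 : ℝ) / 2)) := by norm_num
    rw [e]
    ring
  have hGc : ContinuousOn G (Icc a σ) := fun s hs =>
    (hGd s hs.1).continuousAt.continuousWithinAt
  have hconst := constant_of_has_deriv_right_zero hGc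
    (fun s hs => (hGd s hs.1).hasDerivWithinAt) σ ⟨hσ, le_rfl⟩
  have hGa : G a = 0 := by
    simp only [hG, hga]
    ring
  have hGσ : G σ = 0 := hconst.trans hGa
  simp only [hG] at hGσ
  linarith

/-- A continuous (here: differentiable) `g` is bounded on the compact interval `[0, a]`. [folklore] -/
theorem exists_bound_primitive (hg : ∀ σ, HasDerivAt g (h σ) σ) (a : ℝ) :
    ∃ B : ℝ, 0 ≤ B ∧ ∀ σ ∈ Icc (0 : ℝ) a, |g σ| ≤ B := by
  have hc : Continuous g := continuous_iff_continuousAt.2 fun σ => (hg σ).continuousAt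
  obtain ⟨B, hB⟩ := (isCompact_Icc : IsCompact (Icc (0 : ℝ) a)).exists_bound_of_continuousOn hc.continuousOn
  refine ⟨max B 0, le_max_right _ _, fun σ hσ => ?_⟩
  have := hB σ hσ
  rw [Real.norm_eq_abs] at this
  exact this.trans (le_max_left _ _)

end Primitive

end Summit.NavierStokesRegularity.NavierStokesRegularity.Theorems.PowerGaugeEulerLiouville.PressureFloor

end
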